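/-
COR-CM (cell pub-hodgecm2) — Δ2 ORIENTATION RE-KEY: the CONJUGATE-LABELLED seesaw context (own-crow g93's W-B″ check (β), INBOX 2026-08-23T22:32Z).
Seat rekey-l0-pin-a g0 (prover-pub-hodgecm2-rekey-l0-pin-a-g0-0).  NEW additive leaf; imports LANDED modules only (✔ `Rekey/Binders/LiftTypeConj`, ✔ `CM/Lemmas`); no in-place edit.
KERNEL ONLY: 1 reducible abbrev (`SeesawCtx.conjLabel`, a context CONSTRUCTOR, not a named fact) + theorems; 0 `def … : Prop`, no sorry.
FRAMING: HC_CM is NOT proved; «Δ2 BRIDGE CLOSED» is NOT claimed; HELD pending orientation re-key.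
-/
import Summits.HodgeConjecture.CorCM.Rekey.Binders.LiftTypeConj
import Summits.HodgeConjecture.HodgeCM.CM.Lemmas

set_option autoImplicit false

/-!
# The sign recipe's good-context guard is invariant under CONJUGATING THE LABELS of a seesaw context

For a seesaw context `c = ⟨K, Ψ, σ, D⟩` put `c̄ := ⟨K, bar ∘ Ψ, conjugate σ, D⟩` — SAME lines `D` (hence the same theta data, the same
bit, the same structural embedding `ι₁`), conjugate CM types and conjugate eigen-embedding.  Then for every recipe bit `h` and every `ι₁`:

  `SignRecipe.GoodCtx h ι₁ c̄ ↔ SignRecipe.GoodCtx h ι₁ c`   (`goodCtx_conjLabel_iff`).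

Field by field: `pairSum` — `ind (bar Ψ) = 1 − ind Ψ`, so the tetrahedron identity is preserved; `injective` — `bar` is involutive;
`mem` — `conjugate σ ∈ bar Ψ_i ↔ σ ∈ Ψ_i`; `forced` — with the guard's `j` replaced by `c_L ∘ j` (`ι₁ ∘ (c_L ∘ j) = conjugate (ι₁ ∘ j)`), the type
recipe transforms as `κ_h(c_L ∘ j)(τ) = conjugate (κ_h(j)(τ))` (✔ `SignRecipe.kappa_conjRingHomK_comp`, subcorner pair's landed leaf
`CorCM/Rekey/Binders/LiftTypeConj.lean`, IMPORTED — centrality of `c_L` in `Aut L`) and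
`ind (bar Ψ) (conjugate κ) = 1 ↔ ind Ψ κ = 1`, so `reqPos` and `SignsForced` are UNCHANGED (`reqPos_conjRingHomK_comp_bar`,
`signsForced_conjRingHomK_comp_bar_iff`) — NB at the SAME distinguished embedding `ι₁` the frame sign does not move (contrast `GoodCtxConj.lean`'s
`ῑ₁`-slot lemma, where two flips cancel).
USE (own-crow's W-B″, check (β)): `c ↦ c̄` is an involution of the good contexts of any END-state theta model (`AdelicThetaCore.thetaModel_goodCtx_iff`),
and the theta-side constructors read `c` only through `c.D` and the guard (grep census, INBOX 2026-08-23T22:4xZ), so `Theta V c̄ = Theta V c` reduces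
to this file.
-/

noncomputable section

open NumberField NumberField.ComplexEmbedding
open scoped ComplexConjugate
open Literature.AlgebraicGeometry.Motives (CMType)
open Literature.AlgebraicGeometry.ShimuraVarieties (conjRingHomK embedding_conjRingHomK)

namespace HodgeCM

namespace Rekey

open HodgeCM.SignRecipe HodgeCM.CMTypeOps

variable {K L : CMField}

/-! ## §1 Bookkeeping: `bar` on indicators and injectivity, `c_L` is an involution -/

/-- `c_L ∘ c_L = id` on elements. [folklore] -/
theorem conjRingHomK_conjRingHomK (x : L) : conjRingHomK L (conjRingHomK L x) = x := by
  obtain ⟨ι⟩ := (inferInstance : Nonempty ((L : Type) →+* ℂ))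
  apply ι.injective
  rw [embedding_conjRingHomK, embedding_conjRingHomK, starRingEnd_self_apply]

/-- `ι₁ ∘ (c_L ∘ j) = conjugate (ι₁ ∘ j)`. [folklore] -/
theorem comp_conjRingHomK_comp (ι₁ : L →+* ℂ) (j : K →+* L) :
    ι₁.comp ((conjRingHomK L).comp j) = conjugate (ι₁.comp j) := by
  ext x
  rw [RingHom.comp_apply, RingHom.comp_apply, embedding_conjRingHomK, conjugate_coe_eq, RingHom.comp_apply]

/-! ## §2 The type recipe and the required signs along `c_L ∘ j` for the conjugate type -/

/-- the indicator of the CONJUGATE type at the CONJUGATE embedding is the indicator. [folklore] -/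
theorem ind_bar_conjugate_eq_one_iff (Ψ : CMType K) (φ : K →+* ℂ) : ind (bar Ψ) (conjugate φ) = 1 ↔ ind Ψ φ = 1 := by
  rw [ind_eq_one_iff, ind_eq_one_iff, mem_bar_iff, conjugate_mem_iff_notMem, not_not]

/-- **the required sign is unchanged**: `reqPos h K L (c_L ∘ j) ι₁ (bar Ψ) τ = reqPos h K L j ι₁ Ψ τ`. [folklore] -/
theorem reqPos_conjRingHomK_comp_bar (h : Bool) (j : K →+* L) (ι₁ : L →+* ℂ) (Ψ : CMType K) (τ : L →+* ℂ) :
    reqPos h K L ((conjRingHomK L).comp j) ι₁ (bar Ψ) τ = reqPos h K L j ι₁ Ψ τ := by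
  unfold reqPos
  rw [kappa_conjRingHomK_comp]
  by_cases hκ : ind Ψ (kappa h K L j ι₁ τ) = 1
  · rw [if_pos ((ind_bar_conjugate_eq_one_iff Ψ _).2 hκ), if_pos hκ]
  · rw [if_neg (fun h' => hκ ((ind_bar_conjugate_eq_one_iff Ψ _).1 h')), if_neg hκ]

/-- **the forced signs are unchanged** along `c_L ∘ j` for the conjugate types. [folklore] -/
theorem signsForced_conjRingHomK_comp_bar_iff (h : Bool) (j : K →+* L) (ι₁ : L →+* ℂ) (Ψ : Fin 4 → CMType K)
    (D : StubTree.SeesawDatum L) :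
    SignsForced h K L ((conjRingHomK L).comp j) ι₁ (fun i => bar (Ψ i)) D ↔ SignsForced h K L j ι₁ Ψ D := by
  unfold SignsForced
  exact forall_congr' fun i => forall_congr' fun τ => by rw [reqPos_conjRingHomK_comp_bar]

/-! ## §3 The conjugate-labelled context and the guard -/

/-- **the CONJUGATE-LABELLED context** `c̄ := ⟨c.K, bar ∘ c.Ψ, conjugate c.σ, c.D⟩` — same lines, conjugate labels. [folklore] -/
abbrev _root_.HodgeCM.SeesawCtx.conjLabel (c : SeesawCtx L) : SeesawCtx L :=
  ⟨c.K, fun i => bar (c.Ψ i), conjugate c.σ, c.D⟩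

/-- `c̄.D = c.D` (`rfl`). [folklore] -/
theorem conjLabel_D (c : SeesawCtx L) : c.conjLabel.D = c.D := rfl

/-- `c̄̄ = c`. [folklore] -/
theorem conjLabel_conjLabel (c : SeesawCtx L) : c.conjLabel.conjLabel = c := by
  obtain ⟨K, Ψ, σ, D⟩ := c
  have bar_bar : ∀ Φ : CMType K, bar (bar Φ) = Φ := fun Φ =>
    Subtype.ext (Set.ext fun φ => by rw [mem_bar_iff, mem_bar_iff, not_not])
  simp only [SeesawCtx.conjLabel, bar_bar, involutive_conjugate _ σ]

/-- the pair-sum identity is invariant under `bar`. [folklore] -/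
theorem pairSum_bar_iff (Ψ : Fin 4 → CMType K) : PairSum (fun i => bar (Ψ i)) ↔ PairSum Ψ := by
  have ind_bar : ∀ (Φ : CMType K) (φ : K →+* ℂ), ind (bar Φ) φ = 1 - ind Φ φ := fun Φ φ => by
    by_cases hφ : φ ∈ Φ.1
    · rw [ind_of_mem hφ, ind_of_not_mem (show φ ∉ (bar Φ).1 from fun h => (mem_bar_iff Φ φ).1 h hφ)]; rfl
    · rw [ind_of_not_mem hφ, ind_of_mem ((mem_bar_iff Φ φ).2 hφ)]; rfl
  unfold PairSum
  refine forall_congr' fun φ => ?_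
  simp only [ind_bar]
  omega

/-- **THE GUARD IS INVARIANT UNDER CONJUGATING THE LABELS**: `GoodCtx h ι₁ c̄ ↔ GoodCtx h ι₁ c` (own-crow's W-B″ check (β)). [folklore] -/
theorem goodCtx_conjLabel_iff (h : Bool) (ι₁ : L →+* ℂ) (c : SeesawCtx L) :
    SignRecipe.GoodCtx h ι₁ c.conjLabel ↔ SignRecipe.GoodCtx h ι₁ c := by
  constructor
  · rintro ⟨hps, hinj, hmem, j, hj, hs⟩
    refine ⟨(pairSum_bar_iff c.Ψ).1 hps, fun a b hab => hinj (congrArg bar hab : bar (c.Ψ a) = bar (c.Ψ b)), fun i => ?_,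
      (conjRingHomK L).comp j, ?_, ?_⟩
    · have hm := hmem i
      change conjugate c.σ ∈ (bar (c.Ψ i)).1 at hm
      rwa [mem_bar_iff, conjugate_mem_iff_notMem, not_not] at hm
    · rw [comp_conjRingHomK_comp, show ι₁.comp j = conjugate c.σ from hj]
      exact involutive_conjugate _ c.σ
    · have hj' : j = (conjRingHomK L).comp ((conjRingHomK L).comp j) := by
        ext x; rw [RingHom.comp_apply, RingHom.comp_apply, conjRingHomK_conjRingHomK]
      rw [hj'] at hs
      exact (signsForced_conjRingHomK_comp_bar_iff h _ ι₁ c.Ψ c.D).1 hs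
  · rintro ⟨hps, hinj, hmem, j, hj, hs⟩
    refine ⟨(pairSum_bar_iff c.Ψ).2 hps, fun a b hab => hinj ?_, fun i => ?_, (conjRingHomK L).comp j, ?_,
      (signsForced_conjRingHomK_comp_bar_iff h j ι₁ c.Ψ c.D).2 hs⟩
    · have hbb : ∀ Φ : CMType c.K, bar (bar Φ) = Φ := fun Φ =>
        Subtype.ext (Set.ext fun φ => by rw [mem_bar_iff, mem_bar_iff, not_not])
      have := congrArg bar (hab : bar (c.Ψ a) = bar (c.Ψ b))
      rwa [hbb, hbb] at this
    · change conjugate c.σ ∈ (bar (c.Ψ i)).1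
      rw [mem_bar_iff, conjugate_mem_iff_notMem, not_not]
      exact hmem i
    · change ι₁.comp ((conjRingHomK L).comp j) = conjugate c.σ
      rw [comp_conjRingHomK_comp, hj]

/-- hence for every END-state theta model: `R.GoodCtx ι₁ c̄ ↔ R.GoodCtx ι₁ c`. [folklore] -/
theorem thetaModel_goodCtx_conjLabel_iff {U : Universe} {hP : PrintFact_unitaryCompact} (C : U.AdelicThetaCore hP) (h : Bool)
    (d12 d34 : ∀ {L : CMField}, SeesawCtx L → Universe.SideData L) (ι₁ : L →+* ℂ) (c : SeesawCtx L) :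
    (C.thetaModel h d12 d34).GoodCtx ι₁ c.conjLabel ↔ (C.thetaModel h d12 d34).GoodCtx ι₁ c := by
  rw [C.thetaModel_goodCtx_iff h d12 d34, C.thetaModel_goodCtx_iff h d12 d34, goodCtx_conjLabel_iff]

end Rekey

end HodgeCM

end
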